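/-
Copyright (c) 2026 the pub-hodgecm-mathlib formalisation cell (harness21).  Prover seat hodgecm-mathlib-F0P3-p02 (g26), 2026-09-03.  E1 row 41d R-d «THE FINITE SCHNEIDER–STUHLER
COMPLEX ON A STABLE SUBTREE», FILE I «MODULES, MAPS, EXACTNESS, FINITENESS» (E1 keeper ∕ dealer F0P3a-p03 (g29) 01:36:07Z ∕ 01:39:03Z; census row 38 `CENSUS-SSK-via-resolution.v1`
(F0P3a-p04 (g31)) §3 (A5) + (A10)-glue).
-/
import Literature.NumberTheory.Automorphic.SchneiderStuhlerTreeExactnessConvex   -- ★ row 34b `exists_finsupp_fixedPoints_boundary_eq_of_support_subset`; brings ★ row 34 (`finsupp_boundary_injective_of_isTree`, `boundary_add`) and ★ `OrientedIncidence`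
import Mathlib.LinearAlgebra.Finsupp.Span                                          -- `Finsupp.disjoint_lsingle_lsingle`
import Mathlib.LinearAlgebra.DFinsupp                                              -- `Submodule.mem_iSup_iff_exists_finsupp`
import Mathlib.LinearAlgebra.FiniteDimensional.Basic                               -- `Submodule.finiteDimensional_finset_sup`, `Submodule.finiteDimensional_of_le`
import HarnessLib

/-!
# The finite Schneider–Stuhler complex of a subtree: `0 → C₁(Σ) →∂ C₀(Σ) →ε V|_Σ → 0` as submodules and linear maps; exactness; finite-dimensionality; the block decomposition

Topic `NumberTheory/Automorphic` (declarations in the `Representation` namespace, next to ★ rows 34 ∕ 34b).  THEOREMS ONLY (no definition, no instance, no notation, no named fact,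
no `sorry`): the three chain modules are the CLOSED TERMS
  `C₀(Σ) := ⨆ x ∈ Σ, (V^{U_x}).map (Finsupp.lsingle x) ≤ (ι →₀ V)`, `C₁(Σ) := ⨆ e ∈ Σ¹, (V^{U_{head e} ⊔ U_{tail e}}).map (Finsupp.lsingle e) ≤ (G.edgeSet →₀ V)`
  (`Σ¹` = the edges with both ends in `Σ`), `V|_Σ := ⨆ x ∈ Σ, V^{U_x} ≤ V`,
and the two maps are taken HYPOTHESIS-STYLE as `D : (G.edgeSet →₀ V) →ₗ[k] (ι →₀ V)` with `hD : ∀ c u, D c u = c.sum fun e m => σ.incMatrix k u e • m` (★ row 34's boundary) and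
`E : (ι →₀ V) →ₗ[k] V` with `hE : ∀ v, E v = v.sum fun _ m => m` (the augmentation), both of which EXIST (§1).  Cell `pub/hodgecm-mathlib` (D-0151), crux H413 =
`stmt-HodgeConjecture-24833`, lane `--supports`; E1 BRICK LEDGER row 41d = census row 38 §5 R-d (the plumbing on which R-e «invariants are exact», R-f «(SS-K) uniform» and (SS-E)
run).  HONEST LABEL: count-neutral generic base layer; E1 = PRINT until the keeper's charter test; (R-SS) NOT chartered; HC_CM is proved only modulo the 2 remaining named inputs
(hLiu418 = `stmt-HodgeConjecture-24832`, h413 = `stmt-HodgeConjecture-24833`) until rung 0 closes.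

THE MATHEMATICS ([SchneiderStuhler1997] II.3 ∕ III.4; [MeyerSolleveld2010] Thm. 2.4, §4 Prop. 4.1; [Korman2004] §4).  `G` a tree on `ι` with an orientation `σ`, `U : ι → Subgroup Γ` compact vertex
groups ((U6) on edges, (U7) along first steps of geodesics — letters of ★ row 34), `ρ` a SMOOTH representation of `Γ` on the `k`-space `V` (`char k = 0`), `Σ ⊆ ι` a vertex set, root-closed
toward a root `r` (contains the parent of each of its vertices — the convex subtrees through `r`; e.g. a closed ball around `r`).
* §1 MEMBERSHIP in the closed terms: `v ∈ C₀(Σ) ↔ supp v ⊆ Σ ∧ ∀ x, v x ∈ V^{U_x}` (`mem_zeroChains_iff`), `c ∈ C₁(Σ) ↔ (∀ e ∈ supp c, both ends in Σ) ∧ ∀ e, c e ∈ V^{U_e}`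
  (`mem_oneChains_iff`); EXISTENCE of `D` (`exists_boundaryMap`) and `E` (`exists_augmentationMap`).
* §2 MAPPING: `D (C₁(Σ)) ⊆ C₀(Σ)` (`boundaryMap_mem_zeroChains`), `E ∘ D = 0` (`augmentationMap_boundaryMap`), `E (C₀(Σ)) ⊆ V|_Σ` (`augmentationMap_mem_restricted`), `E : C₀(Σ) → V|_Σ`
  ONTO (`exists_mem_zeroChains_augmentationMap_eq`).
* §3 EXACTNESS: `D` injective (★ row 34, `boundaryMap_injective`); `v ∈ C₀(Σ)`, `E v = 0` ⇒ `v = D c`, `c ∈ C₁(Σ)` (★ row 34b, `exists_mem_oneChains_boundaryMap_eq`); and the SHORT EXACT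
  SEQUENCE in Mathlib's letters for the restricted maps `i := D|: C₁(Σ) → C₀(Σ)`, `q := E|: C₀(Σ) → V|_Σ` — **`shortExact_restrict`**: `Injective i ∧ range i = ker q ∧ Surjective q`.
* §4 FINITENESS: `Σ` finite and the blocks `V^{U_x}` (`x ∈ Σ`), `V^{U_e}` (`e ∈ Σ¹`) finite-dimensional (admissibility; `U` compact OPEN) ⇒ `C₀(Σ), C₁(Σ), V|_Σ` finite-dimensional.
* §5 BLOCKS: the single-vertex blocks `(V^{U_x}).map (lsingle x)`, `x ∈ Σ`, are INDEPENDENT (`iSupIndep_zeroBlocks`) — with `C₀(Σ)` being their `⨆` BY DEFINITION this is the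
  `DirectSum.IsInternal` input of ★ row 37 `LinearMap.trace_eq_sum_trace_restrict_fixed_of_mapsTo` (Mathlib `DirectSum.isInternal_biSup_submodule_of_iSupIndep`); likewise for edges.
The ACTION of the stabiliser of `Σ` on the three modules and the equivariance of `D`, `E` is FILE II (`SchneiderStuhlerTreeComplexAction`).

## References
* [SchneiderStuhler1997] P. Schneider, U. Stuhler, *Representation theory and sheaves on the Bruhat–Tits building*, Publ. Math. IHÉS 85 (1997): Ch. II §3 p. 123 (the oriented chain
  complex of the coefficient system `F ↦ V^{U_F^{(e)}}`), Ch. III §4 (its use on the finite fixed subcomplex).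
* [MeyerSolleveld2010] R. Meyer, M. Solleveld, *Resolutions for representations of reductive p-adic groups via their buildings*, J. reine angew. Math. 647 (2010): Thm. 2.4 and §4
  Prop. 4.1 (the complex of a finite convex `𝒦`-stable subcomplex `Σ` resolves `V|_Σ = Σ_{x ∈ Σ} V_x` by finite-dimensional modules).
* [Korman2004] J. Korman, *A character formula for compact elements (the rank one case)*, arXiv:math/0409292: §4 (the complex `0 → C₁ → C₀ → V → 0` on the tree).
* [GodsilRoyle2001] C. Godsil, G. Royle, *Algebraic Graph Theory* (2001): §8.3 (the oriented incidence matrix — the boundary letters).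
-/

set_option autoImplicit false

open scoped BigOperators Pointwise
open SimpleGraph Finset
open Literature.NumberTheory.Automorphic Literature.Combinatorics.SimpleGraph Literature.Combinatorics.SimpleGraph.OrientedIncidence

namespace Representation

variable {k Γ V : Type*} [Field k] [CharZero k] [Group Γ] [TopologicalSpace Γ] [IsTopologicalGroup Γ]
  [AddCommGroup V] [Module k V] {ρ : Representation k Γ V}
variable {ι : Type*} [DecidableEq ι] {G : SimpleGraph ι}

/-! ## §1 The modules as closed terms; membership; the maps `D`, `E` exist -/

omit [CharZero k] [TopologicalSpace Γ] [IsTopologicalGroup Γ] [DecidableEq ι] in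
/-- **MEMBERSHIP IN `C₀(Σ) = ⨆_{x ∈ Σ} (V^{U_x})·[x]`**: a finitely supported `v : ι →₀ V` lies in `C₀(Σ)` iff `supp v ⊆ Σ` and `v x ∈ V^{U_x}` for every `x`.
[cite: SchneiderStuhler1997, Ch. II §3 p. 123] [cite: Korman2004, §4] -/
theorem mem_zeroChains_iff (U : ι → Subgroup Γ) (S : Set ι) (v : ι →₀ V) :
    v ∈ (⨆ x ∈ S, (ρ.fixedPoints (U x)).map (Finsupp.lsingle x : V →ₗ[k] ι →₀ V)) ↔
      (∀ x ∈ v.support, x ∈ S) ∧ ∀ x, v x ∈ ρ.fixedPoints (U x) := by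
  classical
  constructor
  · intro hv
    -- the right-hand side is a submodule containing every block
    let P : Submodule k (ι →₀ V) :=
      { carrier := {v | (∀ x ∈ v.support, x ∈ S) ∧ ∀ x, v x ∈ ρ.fixedPoints (U x)}
        zero_mem' := ⟨fun x hx => absurd hx (by simp), fun x => by simp⟩
        add_mem' := fun {a b} ha hb => ⟨fun x hx => by
            rcases Finset.mem_union.1 (Finsupp.support_add hx) with h | h
            · exact ha.1 x h
            · exact hb.1 x h,
          fun x => by rw [Finsupp.add_apply]; exact Submodule.add_mem _ (ha.2 x) (hb.2 x)⟩
        smul_mem' := fun c a ha => ⟨fun x hx => ha.1 x (Finsupp.support_smul hx),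
          fun x => by rw [Finsupp.smul_apply]; exact Submodule.smul_mem _ _ (ha.2 x)⟩ }
    have hle : (⨆ x ∈ S, (ρ.fixedPoints (U x)).map (Finsupp.lsingle x : V →ₗ[k] ι →₀ V)) ≤ P := by
      refine iSup_le fun x => iSup_le fun hx => ?_
      rintro _ ⟨m, hm, rfl⟩
      refine ⟨fun y hy => ?_, fun y => ?_⟩
      · have := Finsupp.support_single_subset hy
        rw [Finset.mem_singleton] at this
        rw [this]; exact hx
      · change Finsupp.single x m y ∈ _
        by_cases hyx : y = x
        · subst hyx; rw [Finsupp.single_eq_same]; exact hm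
        · rw [Finsupp.single_eq_of_ne hyx]; exact Submodule.zero_mem _
    exact hle hv
  · rintro ⟨hS, hfix⟩
    rw [← Finsupp.sum_single v]
    refine Submodule.sum_mem _ fun x hx => ?_
    exact Submodule.mem_iSup_of_mem x (Submodule.mem_iSup_of_mem (hS x hx) ⟨v x, hfix x, rfl⟩)

omit [CharZero k] [TopologicalSpace Γ] [IsTopologicalGroup Γ] [DecidableEq ι] in
/-- **MEMBERSHIP IN `C₁(Σ) = ⨆_{e ∈ Σ¹} (V^{U_e})·[e]`** (`Σ¹` = edges with head and tail in `Σ`): `c : G.edgeSet →₀ V` lies in `C₁(Σ)` iff every edge of its support has both ends in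
`Σ` and `c e ∈ V^{U_{head e} ⊔ U_{tail e}}` for every `e`. [cite: SchneiderStuhler1997, Ch. II §3 p. 123] [cite: Korman2004, §4] -/
theorem mem_oneChains_iff (σ : Orientation G) (U : ι → Subgroup Γ) (S : Set ι) (c : G.edgeSet →₀ V) :
    c ∈ (⨆ e ∈ {e : G.edgeSet | σ.head e ∈ S ∧ σ.tail e ∈ S}, (ρ.fixedPoints (U (σ.head e) ⊔ U (σ.tail e))).map (Finsupp.lsingle e : V →ₗ[k] G.edgeSet →₀ V)) ↔
      (∀ e ∈ c.support, σ.head e ∈ S ∧ σ.tail e ∈ S) ∧ ∀ e, c e ∈ ρ.fixedPoints (U (σ.head e) ⊔ U (σ.tail e)) := by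
  classical
  constructor
  · intro hc
    let P : Submodule k (G.edgeSet →₀ V) :=
      { carrier := {c | (∀ e ∈ c.support, σ.head e ∈ S ∧ σ.tail e ∈ S) ∧ ∀ e, c e ∈ ρ.fixedPoints (U (σ.head e) ⊔ U (σ.tail e))}
        zero_mem' := ⟨fun e he => absurd he (by simp), fun e => by simp⟩
        add_mem' := fun {a b} ha hb => ⟨fun e he => by
            rcases Finset.mem_union.1 (Finsupp.support_add he) with h | h
            · exact ha.1 e h
            · exact hb.1 e h,
          fun e => by rw [Finsupp.add_apply]; exact Submodule.add_mem _ (ha.2 e) (hb.2 e)⟩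
        smul_mem' := fun r a ha => ⟨fun e he => ha.1 e (Finsupp.support_smul he),
          fun e => by rw [Finsupp.smul_apply]; exact Submodule.smul_mem _ _ (ha.2 e)⟩ }
    have hle : (⨆ e ∈ {e : G.edgeSet | σ.head e ∈ S ∧ σ.tail e ∈ S},
        (ρ.fixedPoints (U (σ.head e) ⊔ U (σ.tail e))).map (Finsupp.lsingle e : V →ₗ[k] G.edgeSet →₀ V)) ≤ P := by
      refine iSup_le fun e => iSup_le fun he => ?_
      rintro _ ⟨m, hm, rfl⟩
      refine ⟨fun e' he' => ?_, fun e' => ?_⟩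
      · have := Finsupp.support_single_subset he'
        rw [Finset.mem_singleton] at this
        rw [this]; exact he
      · change Finsupp.single e m e' ∈ _
        by_cases hee : e' = e
        · subst hee; rw [Finsupp.single_eq_same]; exact hm
        · rw [Finsupp.single_eq_of_ne hee]; exact Submodule.zero_mem _
    exact hle hc
  · rintro ⟨hS, hfix⟩
    rw [← Finsupp.sum_single c]
    refine Submodule.sum_mem _ fun e he => ?_
    exact Submodule.mem_iSup_of_mem e (Submodule.mem_iSup_of_mem (hS e he) ⟨c e, hfix e, rfl⟩)

omit [CharZero k] [TopologicalSpace Γ] [IsTopologicalGroup Γ] [DecidableEq ι] in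
/-- **MEMBERSHIP IN `V|_Σ = ⨆_{x ∈ Σ} V^{U_x}`** of a finite sum: `Σ_{x ∈ supp v} v x ∈ V|_Σ` for `v ∈ C₀(Σ)`-data. [cite: MeyerSolleveld2010, Thm. 2.4] -/
theorem finsupp_sum_mem_restricted (U : ι → Subgroup Γ) (S : Set ι) {v : ι →₀ V} (hS : ∀ x ∈ v.support, x ∈ S)
    (hfix : ∀ x, v x ∈ ρ.fixedPoints (U x)) : (v.sum fun _ m => m) ∈ ⨆ x ∈ S, ρ.fixedPoints (U x) :=
  Submodule.sum_mem _ fun x hx => Submodule.mem_iSup_of_mem x (Submodule.mem_iSup_of_mem (hS x hx) (hfix x))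

omit [CharZero k] [Group Γ] [TopologicalSpace Γ] [IsTopologicalGroup Γ] in
/-- **THE BOUNDARY AS A LINEAR MAP EXISTS**: there is `D : (G.edgeSet →₀ V) →ₗ[k] (ι →₀ V)` with `(D c) u = Σ_e D_{ue} • c e` (★ row 34's boundary), namely
`c ↦ Σ_e (c e·[head e] − c e·[tail e])`. [cite: GodsilRoyle2001, §8.3 (p. 167)] [cite: SchneiderStuhler1997, Ch. II §3 p. 123] -/
theorem exists_boundaryMap (σ : Orientation G) :
    ∃ D : (G.edgeSet →₀ V) →ₗ[k] (ι →₀ V), ∀ (c : G.edgeSet →₀ V) (u : ι), D c u = c.sum fun e m => σ.incMatrix k u e • m := by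
  classical
  refine ⟨Finsupp.lsum ℕ fun e : G.edgeSet => (Finsupp.lsingle (σ.head e) : V →ₗ[k] ι →₀ V) - Finsupp.lsingle (σ.tail e), fun c u => ?_⟩
  rw [Finsupp.lsum_apply, Finsupp.sum, Finsupp.sum, Finsupp.finsetSum_apply]
  refine Finset.sum_congr rfl fun e _ => ?_
  rw [LinearMap.sub_apply, Finsupp.sub_apply, Finsupp.lsingle_apply, Finsupp.lsingle_apply, Finsupp.single_apply, Finsupp.single_apply,
    Orientation.incMatrix_apply, sub_smul, ite_smul, ite_smul, one_smul, zero_smul]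
  simp only [eq_comm]

omit [CharZero k] [Group Γ] [TopologicalSpace Γ] [IsTopologicalGroup Γ] [DecidableEq ι] in
/-- **THE AUGMENTATION AS A LINEAR MAP EXISTS**: `E v = Σ_x v x`. [cite: SchneiderStuhler1997, Ch. II §3 p. 123] -/
theorem exists_augmentationMap : ∃ E : (ι →₀ V) →ₗ[k] V, ∀ v : ι →₀ V, E v = v.sum fun _ m => m :=
  ⟨Finsupp.lsum ℕ fun _ : ι => (LinearMap.id : V →ₗ[k] V), fun v => by rw [Finsupp.lsum_apply]; rfl⟩

/-! ## §2 Mapping properties of `D` and `E` -/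

section Maps

variable (σ : Orientation G) (U : ι → Subgroup Γ) (S : Set ι)
variable {D : (G.edgeSet →₀ V) →ₗ[k] (ι →₀ V)} (hD : ∀ (c : G.edgeSet →₀ V) (u : ι), D c u = c.sum fun e m => σ.incMatrix k u e • m)
variable {E : (ι →₀ V) →ₗ[k] V} (hE : ∀ v : ι →₀ V, E v = v.sum fun _ m => m)

omit [CharZero k] [TopologicalSpace Γ] [IsTopologicalGroup Γ] in
include hD in
/-- **`D (C₁(Σ)) ⊆ C₀(Σ)`**: the boundary of a `1`-chain supported on edges of `Σ` with `c e ∈ V^{U_e}` is supported in `Σ` with `x`-coefficient in `V^{U_x}` (`V^{U_e} ⊆ V^{U_x}` for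
`x` an end of `e`). [cite: SchneiderStuhler1997, Ch. II §3 p. 123] [cite: Korman2004, §4] -/
theorem boundaryMap_mem_zeroChains {c : G.edgeSet →₀ V}
    (hc : c ∈ ⨆ e ∈ {e : G.edgeSet | σ.head e ∈ S ∧ σ.tail e ∈ S}, (ρ.fixedPoints (U (σ.head e) ⊔ U (σ.tail e))).map (Finsupp.lsingle e : V →ₗ[k] G.edgeSet →₀ V)) :
    D c ∈ ⨆ x ∈ S, (ρ.fixedPoints (U x)).map (Finsupp.lsingle x : V →ₗ[k] ι →₀ V) := by
  classical
  rw [mem_oneChains_iff] at hc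
  obtain ⟨hcS, hcfix⟩ := hc
  rw [mem_zeroChains_iff]
  -- the coefficient at `u`
  have hcoef : ∀ u, D c u = ∑ e ∈ c.support, σ.incMatrix k u e • c e := fun u => by rw [hD]; rfl
  refine ⟨fun u hu => ?_, fun u => ?_⟩
  · -- `D c u ≠ 0` forces some edge `e ∈ supp c` with `u` an end of `e`
    rw [Finsupp.mem_support_iff, hcoef] at hu
    obtain ⟨e, he, hne⟩ := Finset.exists_ne_zero_of_sum_ne_zero hu
    rw [Orientation.incMatrix_apply] at hne
    by_cases h1 : u = σ.head e
    · rw [h1]; exact (hcS e he).1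
    · by_cases h2 : u = σ.tail e
      · rw [h2]; exact (hcS e he).2
      · rw [if_neg h1, if_neg h2, sub_zero, zero_smul] at hne
        exact absurd rfl hne
  · rw [hcoef]
    refine Submodule.sum_mem _ fun e _ => ?_
    rw [Orientation.incMatrix_apply]
    by_cases h1 : u = σ.head e
    · rw [if_pos h1, if_neg (h1 ▸ σ.head_ne_tail e), sub_zero, one_smul, h1]
      exact ρ.fixedPoints_antitone (le_sup_left : U (σ.head e) ≤ U (σ.head e) ⊔ U (σ.tail e)) (hcfix e)
    · by_cases h2 : u = σ.tail e
      · rw [if_neg h1, if_pos h2, zero_sub, neg_smul, one_smul, h2]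
        exact Submodule.neg_mem _ (ρ.fixedPoints_antitone (le_sup_right : U (σ.tail e) ≤ U (σ.head e) ⊔ U (σ.tail e)) (hcfix e))
      · rw [if_neg h1, if_neg h2, sub_zero, zero_smul]
        exact Submodule.zero_mem _

omit [CharZero k] [Group Γ] [TopologicalSpace Γ] [IsTopologicalGroup Γ] in
include hD hE in
/-- **`E ∘ D = 0`**: the augmentation of a boundary vanishes (every edge contributes `c e − c e`; discrete Stokes ★ `sum_smul_finsuppBoundary_eq` with the constant cochain `1`).
[cite: SchneiderStuhler1997, Ch. II §3 p. 123] [cite: GodsilRoyle2001, §8.3 (p. 167)] -/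
theorem augmentationMap_boundaryMap (c : G.edgeSet →₀ V) : E (D c) = 0 := by
  classical
  rw [hE]
  -- `Σ_{u ∈ supp (D c)} (D c) u = Σ_{u ∈ A} 1 • (∂c) u` for `A ⊇` ends of `supp c`
  set A : Finset ι := (D c).support ∪ (c.support.image σ.head ∪ c.support.image σ.tail) with hA
  have h1 : ((D c).sum fun _ m => m) = ∑ u ∈ A, (1 : k) • (c.sum fun e m => σ.incMatrix k u e • m) := by
    rw [Finsupp.sum, Finset.sum_subset (Finset.subset_union_left : (D c).support ⊆ A)]
    · exact Finset.sum_congr rfl fun u _ => by rw [one_smul, hD]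
    · intro u _ hu
      exact Finsupp.notMem_support_iff.1 hu
  rw [h1, σ.sum_smul_finsuppBoundary_eq k c (fun _ => (1 : k)) A]
  · simp [Finsupp.sum]
  · intro e he
    exact ⟨Finset.mem_union_right _ (Finset.mem_union_left _ (Finset.mem_image_of_mem _ he)),
      Finset.mem_union_right _ (Finset.mem_union_right _ (Finset.mem_image_of_mem _ he))⟩

omit [CharZero k] [TopologicalSpace Γ] [IsTopologicalGroup Γ] [DecidableEq ι] in
include hE in
/-- **`E (C₀(Σ)) ⊆ V|_Σ`**. [cite: MeyerSolleveld2010, Thm. 2.4] -/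
theorem augmentationMap_mem_restricted {v : ι →₀ V} (hv : v ∈ ⨆ x ∈ S, (ρ.fixedPoints (U x)).map (Finsupp.lsingle x : V →ₗ[k] ι →₀ V)) :
    E v ∈ ⨆ x ∈ S, ρ.fixedPoints (U x) := by
  rw [mem_zeroChains_iff] at hv
  rw [hE]
  exact finsupp_sum_mem_restricted U S hv.1 hv.2

omit [CharZero k] [TopologicalSpace Γ] [IsTopologicalGroup Γ] [DecidableEq ι] in
include hE in
/-- **`E : C₀(Σ) → V|_Σ` IS ONTO**: every `w ∈ ⨆_{x ∈ Σ} V^{U_x}` is a finite sum `Σ_x v_x`, `v_x ∈ V^{U_x}`, `x ∈ Σ` (Mathlib `Submodule.mem_iSup_iff_exists_finsupp`).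
[cite: MeyerSolleveld2010, Thm. 2.4] [cite: SchneiderStuhler1997, Ch. II §3 p. 123] -/
theorem exists_mem_zeroChains_augmentationMap_eq {w : V} (hw : w ∈ ⨆ x ∈ S, ρ.fixedPoints (U x)) :
    ∃ v ∈ ⨆ x ∈ S, (ρ.fixedPoints (U x)).map (Finsupp.lsingle x : V →ₗ[k] ι →₀ V), E v = w := by
  classical
  have hw' : w ∈ ⨆ x, (⨆ (_ : x ∈ S), ρ.fixedPoints (U x)) := hw
  obtain ⟨f, hf, hfw⟩ := (Submodule.mem_iSup_iff_exists_finsupp _ w).1 hw'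
  refine ⟨f, (mem_zeroChains_iff U S f).2 ⟨fun x hx => ?_, fun x => ?_⟩, by rw [hE, hfw]⟩
  · by_contra hxS
    have h0 : f x ∈ (⊥ : Submodule k V) := by
      have := hf x
      rwa [iSup_neg hxS] at this
    exact (Finsupp.mem_support_iff.1 hx) ((Submodule.mem_bot k).1 h0)
  · by_cases hxS : x ∈ S
    · have := hf x
      rwa [iSup_pos hxS] at this
    · have h0 : f x ∈ (⊥ : Submodule k V) := by
        have := hf x
        rwa [iSup_neg hxS] at this
      rw [(Submodule.mem_bot k).1 h0]; exact Submodule.zero_mem _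

/-! ## §3 Exactness -/

omit [CharZero k] [TopologicalSpace Γ] [IsTopologicalGroup Γ] in
include hD in
/-- **`D` IS INJECTIVE** on all finitely supported `1`-chains of a tree (★ row 34 `finsupp_boundary_injective_of_isTree`). [cite: SchneiderStuhler1997, Thm. II.3.1 p. 123] -/
theorem boundaryMap_injective (hT : G.IsTree) : Function.Injective D := by
  intro c c' h
  have key := finsupp_boundary_injective_of_isTree (k := k) (V := V) hT σ
  refine key (funext fun u => ?_)
  show (c.sum fun e m => σ.incMatrix k u e • m) = c'.sum fun e m => σ.incMatrix k u e • m
  rw [← hD, ← hD, h]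

include hD hE in
/-- **`ker E ∩ C₀(Σ) ⊆ D (C₁(Σ))`** for `Σ` root-closed toward `r` (★ row 34b): a `0`-chain of `C₀(Σ)` with augmentation `0` is the boundary of a `1`-chain of `C₁(Σ)` (`G` a tree,
(U6) on edges, (U7) along first steps, `ρ` smooth). [cite: MeyerSolleveld2010, Thm. 2.4] [cite: SchneiderStuhler1997, Thm. II.3.1 p. 123] -/
theorem exists_mem_oneChains_boundaryMap_eq (hT : G.IsTree) (hU : ∀ z, IsCompact (U z : Set Γ))
    (hU6 : ∀ x y, G.Adj x y → ((U x ⊔ U y : Subgroup Γ) : Set Γ) = (U x : Set Γ) * (U y : Set Γ))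
    (hU7 : ∀ x y z, G.Adj x y → G.dist y z + 1 = G.dist x z → ((U y : Subgroup Γ) : Set Γ) ⊆ (U x : Set Γ) * (U z : Set Γ))
    (hρ : ρ.IsSmooth) {r : ι} (hSr : ∀ x ∈ S, ∀ y, G.Adj x y → G.dist r y + 1 = G.dist r x → y ∈ S)
    {v : ι →₀ V} (hv : v ∈ ⨆ x ∈ S, (ρ.fixedPoints (U x)).map (Finsupp.lsingle x : V →ₗ[k] ι →₀ V)) (hv0 : E v = 0) :
    ∃ c ∈ ⨆ e ∈ {e : G.edgeSet | σ.head e ∈ S ∧ σ.tail e ∈ S}, (ρ.fixedPoints (U (σ.head e) ⊔ U (σ.tail e))).map (Finsupp.lsingle e : V →ₗ[k] G.edgeSet →₀ V),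
      D c = v := by
  classical
  rw [mem_zeroChains_iff] at hv
  have hsum : (v.sum fun _ m => m) = 0 := by rw [← hE, hv0]
  obtain ⟨c, hcS, hcfix, -, hcbd⟩ := exists_finsupp_fixedPoints_boundary_eq_of_support_subset hT σ U hU hU6 hU7 hSr v hv.2 (fun z => hρ _) hv.1 hsum
  refine ⟨c, (mem_oneChains_iff σ U S c).2 ⟨hcS, hcfix⟩, ?_⟩
  ext u
  rw [hD, hcbd]

include hD hE in
/-- **THE SHORT EXACT SEQUENCE `0 → C₁(Σ) →ⁱ C₀(Σ) →^q V|_Σ → 0` IN MATHLIB'S LETTERS** for the restricted maps `i = D|` and `q = E|` (the user's `hDC`, `hEC` come from §2):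
`i` injective, `range i = ker q`, `q` surjective — for `G` a tree, (U6)(U7), `ρ` smooth and `Σ` root-closed toward `r`.  This is the finite-dimensional resolution of `V|_Σ` by
`𝒦`-modules of [MeyerSolleveld2010] §4 once FILE II supplies the action. [cite: MeyerSolleveld2010, Thm. 2.4] [cite: SchneiderStuhler1997, Thm. II.3.1 p. 123] [cite: Korman2004, §4] -/
theorem shortExact_restrict (hT : G.IsTree) (hU : ∀ z, IsCompact (U z : Set Γ))
    (hU6 : ∀ x y, G.Adj x y → ((U x ⊔ U y : Subgroup Γ) : Set Γ) = (U x : Set Γ) * (U y : Set Γ))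
    (hU7 : ∀ x y z, G.Adj x y → G.dist y z + 1 = G.dist x z → ((U y : Subgroup Γ) : Set Γ) ⊆ (U x : Set Γ) * (U z : Set Γ))
    (hρ : ρ.IsSmooth) {r : ι} (hSr : ∀ x ∈ S, ∀ y, G.Adj x y → G.dist r y + 1 = G.dist r x → y ∈ S)
    (hDC : ∀ c ∈ ⨆ e ∈ {e : G.edgeSet | σ.head e ∈ S ∧ σ.tail e ∈ S}, (ρ.fixedPoints (U (σ.head e) ⊔ U (σ.tail e))).map (Finsupp.lsingle e : V →ₗ[k] G.edgeSet →₀ V),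
      D c ∈ ⨆ x ∈ S, (ρ.fixedPoints (U x)).map (Finsupp.lsingle x : V →ₗ[k] ι →₀ V))
    (hEC : ∀ v ∈ ⨆ x ∈ S, (ρ.fixedPoints (U x)).map (Finsupp.lsingle x : V →ₗ[k] ι →₀ V), E v ∈ ⨆ x ∈ S, ρ.fixedPoints (U x)) :
    Function.Injective (D.restrict hDC) ∧ LinearMap.range (D.restrict hDC) = LinearMap.ker (E.restrict hEC) ∧ Function.Surjective (E.restrict hEC) := by
  refine ⟨fun c c' h => Subtype.ext (boundaryMap_injective σ hD hT (congrArg Subtype.val h)), ?_, ?_⟩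
  · apply le_antisymm
    · rintro _ ⟨c, rfl⟩
      rw [LinearMap.mem_ker]
      exact Subtype.ext (augmentationMap_boundaryMap σ hD hE c.1)
    · intro v hv
      rw [LinearMap.mem_ker] at hv
      have hv0 : E v.1 = 0 := congrArg Subtype.val hv
      obtain ⟨c, hc, hcv⟩ := exists_mem_oneChains_boundaryMap_eq σ U S hD hE hT hU hU6 hU7 hρ hSr v.2 hv0
      exact ⟨⟨c, hc⟩, Subtype.ext hcv⟩
  · intro w
    obtain ⟨v, hv, hvw⟩ := exists_mem_zeroChains_augmentationMap_eq U S hE w.2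
    exact ⟨⟨v, hv⟩, Subtype.ext hvw⟩

end Maps

/-! ## §4 Finite-dimensionality -/

omit [CharZero k] [Group Γ] [TopologicalSpace Γ] [IsTopologicalGroup Γ] [DecidableEq ι] in
/-- A `⨆` over a finite set is the `⨆` over its `Finset` subtype (so that Mathlib's `Submodule.finiteDimensional_iSup` applies). [cite: MeyerSolleveld2010, §4] -/
theorem biSup_eq_iSup_toFinset {α W : Type*} [AddCommGroup W] [Module k W] (f : α → Submodule k W) {S : Set α} (hS : S.Finite) :
    (⨆ x ∈ S, f x) = ⨆ x : hS.toFinset, f x := by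
  apply le_antisymm
  · exact iSup_le fun x => iSup_le fun hx => le_iSup (fun y : hS.toFinset => f y) ⟨x, hS.mem_toFinset.2 hx⟩
  · exact iSup_le fun y => le_biSup f (hS.mem_toFinset.1 y.2)

omit [CharZero k] [TopologicalSpace Γ] [IsTopologicalGroup Γ] [DecidableEq ι] in
/-- **`V|_Σ` IS FINITE-DIMENSIONAL** for `Σ` finite with finite-dimensional blocks `V^{U_x}`, `x ∈ Σ` (admissibility, `U_x` compact open). [cite: MeyerSolleveld2010, §4] -/
theorem finiteDimensional_restricted (U : ι → Subgroup Γ) {S : Set ι} (hS : S.Finite) (hfd : ∀ x ∈ S, FiniteDimensional k (ρ.fixedPoints (U x))) :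
    FiniteDimensional k ↥(⨆ x ∈ S, ρ.fixedPoints (U x)) := by
  haveI : ∀ y : hS.toFinset, FiniteDimensional k (ρ.fixedPoints (U y)) := fun y => hfd y (hS.mem_toFinset.1 y.2)
  rw [biSup_eq_iSup_toFinset (fun x => ρ.fixedPoints (U x)) hS]
  infer_instance

omit [CharZero k] [TopologicalSpace Γ] [IsTopologicalGroup Γ] [DecidableEq ι] in
/-- **`C₀(Σ)` IS FINITE-DIMENSIONAL** for `Σ` finite with finite-dimensional blocks. [cite: MeyerSolleveld2010, §4] -/
theorem finiteDimensional_zeroChains (U : ι → Subgroup Γ) {S : Set ι} (hS : S.Finite) (hfd : ∀ x ∈ S, FiniteDimensional k (ρ.fixedPoints (U x))) :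
    FiniteDimensional k ↥(⨆ x ∈ S, (ρ.fixedPoints (U x)).map (Finsupp.lsingle x : V →ₗ[k] ι →₀ V)) := by
  haveI : ∀ y : hS.toFinset, FiniteDimensional k ↥((ρ.fixedPoints (U y)).map (Finsupp.lsingle (y : ι) : V →ₗ[k] ι →₀ V)) := fun y =>
    haveI := hfd y (hS.mem_toFinset.1 y.2)
    Module.Finite.map _ _
  rw [biSup_eq_iSup_toFinset (fun x => (ρ.fixedPoints (U x)).map (Finsupp.lsingle x : V →ₗ[k] ι →₀ V)) hS]
  infer_instance

omit [CharZero k] [TopologicalSpace Γ] [IsTopologicalGroup Γ] [DecidableEq ι] in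
/-- The edges with both ends in a finite vertex set form a finite set (an edge is determined by its head and tail). [cite: GodsilRoyle2001, §8.3 (p. 167)] -/
theorem finite_edges_of_finite (σ : Orientation G) {S : Set ι} (hS : S.Finite) : {e : G.edgeSet | σ.head e ∈ S ∧ σ.tail e ∈ S}.Finite := by
  refine Set.Finite.of_injOn (f := fun e : G.edgeSet => (σ.head e, σ.tail e)) (fun e he => Set.mk_mem_prod he.1 he.2) ?_ (hS.prod hS)
  intro e _ e' _ h
  obtain ⟨hh, ht⟩ := Prod.mk.inj h
  apply Subtype.ext
  rw [← σ.mk_head_tail e, ← σ.mk_head_tail e', hh, ht]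

omit [CharZero k] [TopologicalSpace Γ] [IsTopologicalGroup Γ] [DecidableEq ι] in
/-- **`C₁(Σ)` IS FINITE-DIMENSIONAL** for `Σ` finite with finite-dimensional edge blocks `V^{U_e}`, `e ∈ Σ¹`. [cite: MeyerSolleveld2010, §4] -/
theorem finiteDimensional_oneChains (σ : Orientation G) (U : ι → Subgroup Γ) {S : Set ι} (hS : S.Finite)
    (hfd : ∀ e : G.edgeSet, σ.head e ∈ S → σ.tail e ∈ S → FiniteDimensional k (ρ.fixedPoints (U (σ.head e) ⊔ U (σ.tail e)))) :
    FiniteDimensional k ↥(⨆ e ∈ {e : G.edgeSet | σ.head e ∈ S ∧ σ.tail e ∈ S},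
      (ρ.fixedPoints (U (σ.head e) ⊔ U (σ.tail e))).map (Finsupp.lsingle e : V →ₗ[k] G.edgeSet →₀ V)) := by
  have hT := finite_edges_of_finite σ hS
  haveI : ∀ y : hT.toFinset, FiniteDimensional k ↥((ρ.fixedPoints (U (σ.head (y : G.edgeSet)) ⊔ U (σ.tail (y : G.edgeSet)))).map
      (Finsupp.lsingle (y : G.edgeSet) : V →ₗ[k] G.edgeSet →₀ V)) := fun y => by
    have hy := hT.mem_toFinset.1 y.2
    haveI := hfd y hy.1 hy.2
    exact Module.Finite.map _ _
  rw [biSup_eq_iSup_toFinset (fun e : G.edgeSet => (ρ.fixedPoints (U (σ.head e) ⊔ U (σ.tail e))).map (Finsupp.lsingle e : V →ₗ[k] G.edgeSet →₀ V)) hT]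
  infer_instance

/-! ## §5 The blocks are independent (the `DirectSum.IsInternal` input of ★ row 37) -/

omit [CharZero k] [TopologicalSpace Γ] [IsTopologicalGroup Γ] [DecidableEq ι] in
/-- **THE VERTEX BLOCKS ARE INDEPENDENT**: the family `x ↦ (V^{U_x})·[x]` of submodules of `ι →₀ V` is `iSupIndep` (different coordinates; Mathlib `Finsupp.disjoint_lsingle_lsingle`) —
so `C₀(Σ) = ⨆_{x ∈ Σ}` of them is their internal direct sum (Mathlib `DirectSum.isInternal_biSup_submodule_of_iSupIndep`). [cite: SchneiderStuhler1997, Ch. II §3 p. 123] -/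
theorem iSupIndep_zeroBlocks (U : ι → Subgroup Γ) : iSupIndep fun x : ι => (ρ.fixedPoints (U x)).map (Finsupp.lsingle x : V →ₗ[k] ι →₀ V) := by
  classical
  intro x
  have hle : ∀ y : ι, (ρ.fixedPoints (U y)).map (Finsupp.lsingle y : V →ₗ[k] ι →₀ V) ≤ LinearMap.range (Finsupp.lsingle y : V →ₗ[k] ι →₀ V) :=
    fun y => LinearMap.map_le_range
  have h := Finsupp.disjoint_lsingle_lsingle (M := V) (R := k) ({x} : Set ι) {y | y ≠ x} (by simp)
  refine h.mono ?_ ?_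
  · exact (hle x).trans (le_biSup (fun a => LinearMap.range (Finsupp.lsingle a : V →ₗ[k] ι →₀ V)) (Set.mem_singleton x))
  · exact iSup_le fun y => iSup_le fun hy => (hle y).trans (le_biSup (fun a => LinearMap.range (Finsupp.lsingle a : V →ₗ[k] ι →₀ V)) hy)

omit [CharZero k] [TopologicalSpace Γ] [IsTopologicalGroup Γ] [DecidableEq ι] in
/-- **THE EDGE BLOCKS ARE INDEPENDENT**: `e ↦ (V^{U_e})·[e]` is `iSupIndep` in `G.edgeSet →₀ V`. [cite: SchneiderStuhler1997, Ch. II §3 p. 123] -/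
theorem iSupIndep_oneBlocks (σ : Orientation G) (U : ι → Subgroup Γ) :
    iSupIndep fun e : G.edgeSet => (ρ.fixedPoints (U (σ.head e) ⊔ U (σ.tail e))).map (Finsupp.lsingle e : V →ₗ[k] G.edgeSet →₀ V) := by
  classical
  intro e
  have hle : ∀ e' : G.edgeSet, (ρ.fixedPoints (U (σ.head e') ⊔ U (σ.tail e'))).map (Finsupp.lsingle e' : V →ₗ[k] G.edgeSet →₀ V) ≤
      LinearMap.range (Finsupp.lsingle e' : V →ₗ[k] G.edgeSet →₀ V) := fun e' => LinearMap.map_le_range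
  have h := Finsupp.disjoint_lsingle_lsingle (M := V) (R := k) ({e} : Set G.edgeSet) {e' | e' ≠ e} (by simp)
  refine h.mono ?_ ?_
  · exact (hle e).trans (le_biSup (fun a => LinearMap.range (Finsupp.lsingle a : V →ₗ[k] G.edgeSet →₀ V)) (Set.mem_singleton e))
  · exact iSup_le fun e' => iSup_le fun he' => (hle e').trans (le_biSup (fun a => LinearMap.range (Finsupp.lsingle a : V →ₗ[k] G.edgeSet →₀ V)) he')

end Representation
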